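import Summits.QuantumFields.BalabanUV.Beta.MixedJetWard
import Summits.QuantumFields.BalabanUV.Beta.RootedT2JetDictionary

/-!
# `BalabanUV.Beta.BorderJetWard` — binder row D1, «GAUGE-LETTERS» (G3): **THE GAUGE WARD IDENTITY OF THE ROOTED BORDER JET `T2At`**
# (product chart, gauge element `1 + τ_i λD` in the background slot `τ_i`) (β sub-cell, BINDER-OWNERS row D1 OWNER, lineage an2 gen 21)

HONEST FRAMING (cell charter, verbatim): «discharging BetaPertH makes Balaban's UV stability UNCONDITIONAL — a real
constructive-QFT result; it is NOT the continuum limit and NOT the Clay problem.»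
HONEST DEPENDENCY: continuum YM on T⁴ ⇐ BetaPertH ∧ nine spine estimates (0/9 proved); BetaPertH ⇐ (D1) ∧ (D4) ∧ CAP+tail;
G-an2-4 gates asym, D1 and NE2/3/4.
DERIVED cell leaf ([folklore] nested dual numbers + the rooted averaging calculus), BY NAME over G1 `RootedGaugeCovariance.PhiGAt_gauge`
(the group-level gauge covariance, B7 (11) as object locator), an3's `RootedJetReflection` (`GfL`, `GbL`, `PhiLAt`, `QjetLAt`), `RootedJetLinear`
(`QjetLAt_add`, `QjetLAt_τ₁_mul`, `QjetLAt_τ₂_mul`), 33H `RootedJetTwist` (`c11_QjetLAt_twist_of_aug`, `c01/c10_QjetLAt_twist`), 33J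
`RootedT2JetDictionary` (`c10_QjetAt_upF`, `c01_QjetAt_upF`, `QjetAt_upF_neg_B/B′`), leaf-05's `TruncatedNil4Calculus`, G2's letter `βg1`.
No statement of Bałaban's papers, no `[cite:]`, no `Prop` fact; the `def`s are [our object]s (the slot gauge element and its conjugations).
The border twin of G2 `MixedJetWard`; discharges NO letter by itself (G4-B extracts (W2-B) at `vh2Tab`'s letters, after the additivity module
G3b); 0∕4 binders.  NOT D1, NOT `BetaPertH`, NOT continuum, NOT Clay.

WHAT (`r = L·y + ρ`; `a = λ(r)•D`; `ℓ = L^d`; `dA_κ(x) = (λ(x+e_κ) − λ(x))•D` the pure-gauge background; for a spectator `X`: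
`β₁(X)_κ(x) = [λ(x)•D, X_κ(x)]` (G2's `βg1`, rotation at the NEAR end), `βfar(X)_κ(x) = [λ(x+e_κ)•D, X_κ(x)]` (rotation at the FAR end)):
* §1 the slot gauge element `υ t x = 1 + t·ι(λ x•D)`, `ῡ t x = 1 − t·ι(λ x•D)` (`t` central, `t² = 0`, `c00 t = 0`), its lift to `Rho 𝔸`,
  the conjugated data `adυ ω`, `gE E`, `gEb Ē`, and the CHART LEMMAS `gaugeF u ū (GfL ω E) = GfL (adυ ω) (gE E)`, `gaugeB … = GbL (adυ ω) (gEb Ē)`.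
* §2 **MASTER** `QjetLAt_gauge`: for augmentation-one backgrounds, `QjetLAt ρ (adυ ω) (gE E) (gEb Ē) = υ(r) · QjetLAt ρ ω E Ē · ῡ(r)` — EXACT
  (G1 twice; the far gauge factors at `r + L e_μ` cancel inside `Φ · invT Φ₀`).
* §3 the expansions at node 12's letters: slot `τ₁`: `gE (Ebg B B′) = Ebg (B − dA) B′ · (1 + τ₁τ₂ ι βfar(B′))`, `gEb (Ebi B B′) = (1 − τ₁τ₂ ι βfar(B′))
  · Ebi (B − dA) B′`; slot `τ₂`: `gE (Ebg B B′) = Ebg B (B′ − dA) · (1 + τ₁τ₂ ι β₁(B))`, `gEb …` likewise; `adυ (upF W) = upF W + t·upF (β₁ W)`.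
* §4 **THE BORDER JET WARD IDENTITIES** (`(L:𝕜) ≠ 0`, char ≠ 2; scalar fluctuation `upF W`): `c11_QjetAt_gauge₁`:
  `c11 Q^ρ(upF W; dA, X) = (2ℓ²)⁻¹•vhUAt ρ W (βfar X) + (2ℓ²)⁻¹•vhUAt ρ (β₁ W) X − [a, (2ℓ²)⁻¹•vhUAt ρ W X]`, `c11_QjetAt_gauge₂`:
  `c11 Q^ρ(upF W; X, dA) = (2ℓ²)⁻¹•vhUAt ρ W (β₁ X) + (2ℓ²)⁻¹•vhUAt ρ (β₁ W) X − [a, (2ℓ²)⁻¹•vhUAt ρ W X]`, and **`T2At_gauge`** = their sum: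
  every term a FIRST-ORDER (vh) functional — the jet form of an1's site law (W2-B) (spectator rotated at the far end in slot 1 and at the near
  end in slot 2, fluctuation rotated at its base point: an1-g29's certified display (S′)).
Provenance: β sub-cell, unit beta-an2 gen 21, 2026-08-20 (v1); no existing file touched.
-/

namespace Summit.QuantumFields.BalabanUV.Beta.BorderJetWard

open Finset
open Literature.MathematicalPhysics.QuantumFieldTheory.Balaban1983to89
open Literature.MathematicalPhysics.QuantumFieldTheory.Balaban1983to89.Beta
open AffineAveraging (Form1 unitVec)
open AveragingHessianKernelsRooted (vhUAt)
open AveragingThirdJet (Tau Rho dmk fst_dmk snd_dmk dfst_mul dsnd_mul upF upF_apply Ebg Ebi logT invT augR augR_apply gaugeF gaugeB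
  logT_conj)
open AveragingThirdJet.Tau (τ₁ τ₂ τ12 ι c00 c10 c01 c11 mk ext4 τ₁_comm τ₂_comm)
open AveragingMixedJetTables (PhiGAt QjetAt T2At)
open Summit.QuantumFields.BalabanUV.Beta.TruncatedNil4Calculus (nil4_augR eq_invT_of_mul_eq_one mul_invT_eq_one aug_PhiGAt_eq_one)
open Summit.QuantumFields.BalabanUV.Beta.RootedGaugeCovariance (PhiGAt_gauge)
open Summit.QuantumFields.BalabanUV.Beta.RootedJetReflection (GfL GbL PhiLAt QjetLAt fst_GfL snd_GfL fst_GbL snd_GbL augR_GfL augR_GbL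
  QjetAt_eq_QjetLAt)
open Summit.QuantumFields.BalabanUV.Beta.RootedJetLinear (QjetLAt_add QjetLAt_τ₁_mul QjetLAt_τ₂_mul)
open Summit.QuantumFields.BalabanUV.Beta.RootedJetTwist (flip1 c11_flip1 c11_QjetLAt_twist_of_aug c01_QjetLAt_twist c10_QjetLAt_twist)
open Summit.QuantumFields.BalabanUV.Beta.RootedT2JetDictionary (flip2 c11_flip2 c10_QjetAt_upF c01_QjetAt_upF QjetAt_upF_neg_B QjetAt_upF_neg_B')
open Summit.QuantumFields.BalabanUV.Beta.MixedJetWard (βg1)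

variable {𝕜 : Type*} [Field 𝕜] {d : ℕ} {𝔸 : Type*} [Ring 𝔸] [Algebra 𝕜 𝔸]
variable (t : Tau 𝔸) (lam : (Fin d → ℤ) → 𝕜) (D : 𝔸)

/-! ## §1 The slot gauge element, its lift, the conjugated chart data, and the chart lemmas -/

/-- [our object] The gauge element in the background slot `t`: `υ(x) = 1 + t·ι(λ(x)•D)`. -/
def υ (x : Fin d → ℤ) : Tau 𝔸 := 1 + t * ι (lam x • D)

/-- [our object] Its inverse `ῡ(x) = 1 − t·ι(λ(x)•D)`. -/
def ῡ (x : Fin d → ℤ) : Tau 𝔸 := 1 - t * ι (lam x • D)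

/-- [our object] The lift of `υ` to `Rho 𝔸` (no fluctuation part). -/
def uR (x : Fin d → ℤ) : Rho 𝔸 := dmk (υ t lam D x) 0

/-- [our object] The lift of `ῡ`. -/
def ubR (x : Fin d → ℤ) : Rho 𝔸 := dmk (ῡ t lam D x) 0

/-- [our object] The conjugated fluctuation letter `Ad_υ ω`. -/
def adυ (ω : Form1 d (Tau 𝔸)) : Form1 d (Tau 𝔸) := fun κ x => υ t lam D x * ω κ x * ῡ t lam D x

/-- [our object] The gauge-transformed forward background letter `υ(x) E_f ῡ(x + e_κ)`. -/
def gE (E : Form1 d (Tau 𝔸)) : Form1 d (Tau 𝔸) := fun κ x => υ t lam D x * E κ x * ῡ t lam D (x + unitVec κ)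

/-- [our object] The gauge-transformed backward background letter `υ(x + e_κ) Ē_f ῡ(x)`. -/
def gEb (Eb : Form1 d (Tau 𝔸)) : Form1 d (Tau 𝔸) := fun κ x => υ t lam D (x + unitVec κ) * Eb κ x * ῡ t lam D x

/-- [our object] The spectator rotated at the FAR end of its bond: `βfar(X)_κ(x) = (λ(x+e_κ)•D)·X − X·(λ(x+e_κ)•D)`. -/
def βfar (X : Form1 d 𝔸) : Form1 d 𝔸 := fun κ x => (lam (x + unitVec κ) • D) * X κ x - X κ x * (lam (x + unitVec κ) • D)

section Slot

variable {t}
variable (ht2 : t * t = 0) (htc : ∀ q : Tau 𝔸, t * q = q * t)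
include ht2 htc

/-- [folklore] `υ ῡ = 1`. -/
theorem υ_mul_ῡ (x : Fin d → ℤ) : υ t lam D x * ῡ t lam D x = 1 := by
  have h0 : t * ι (lam x • D) * (t * ι (lam x • D)) = 0 := by
    rw [mul_assoc, ← mul_assoc (ι (lam x • D)) t, ← htc (ι (lam x • D)), mul_assoc, ← mul_assoc t t, ht2, zero_mul]
  simp only [υ, ῡ, mul_sub, add_mul, one_mul, mul_one, h0]
  abel

/-- [folklore] `ῡ υ = 1`. -/
theorem ῡ_mul_υ (x : Fin d → ℤ) : ῡ t lam D x * υ t lam D x = 1 := by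
  have h0 : t * ι (lam x • D) * (t * ι (lam x • D)) = 0 := by
    rw [mul_assoc, ← mul_assoc (ι (lam x • D)) t, ← htc (ι (lam x • D)), mul_assoc, ← mul_assoc t t, ht2, zero_mul]
  simp only [υ, ῡ, sub_mul, mul_add, one_mul, mul_one, h0]
  abel

/-- [folklore] `u ū = 1` in `Rho 𝔸`. -/
theorem uR_mul_ubR (x : Fin d → ℤ) : uR t lam D x * ubR t lam D x = 1 :=
  TrivSqZeroExt.ext (by simp [uR, ubR, υ_mul_ῡ lam D ht2 htc]) (by simp [uR, ubR])

/-- [folklore] `ū u = 1` in `Rho 𝔸`. -/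
theorem ubR_mul_uR (x : Fin d → ℤ) : ubR t lam D x * uR t lam D x = 1 :=
  TrivSqZeroExt.ext (by simp [uR, ubR, ῡ_mul_υ lam D ht2 htc]) (by simp [uR, ubR])

/-- [folklore] **FORWARD CHART LEMMA**: `u(x)·(1 + ρω)E·ū(x+e_κ) = (1 + ρ Ad_υω)·(υ E ῡ′)`. -/
theorem gaugeF_GfL (ω E : Form1 d (Tau 𝔸)) : gaugeF (uR t lam D) (ubR t lam D) (GfL ω E) = GfL (adυ t lam D ω) (gE t lam D E) := by
  funext κ x
  refine TrivSqZeroExt.ext ?_ ?_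
  · simp [gaugeF, uR, ubR, gE]
  · have e : υ t lam D x * ω κ x * ῡ t lam D x * (υ t lam D x * E κ x * ῡ t lam D (x + unitVec κ))
        = υ t lam D x * ω κ x * E κ x * ῡ t lam D (x + unitVec κ) := by
      calc υ t lam D x * ω κ x * ῡ t lam D x * (υ t lam D x * E κ x * ῡ t lam D (x + unitVec κ))
          = υ t lam D x * ω κ x * (ῡ t lam D x * υ t lam D x) * E κ x * ῡ t lam D (x + unitVec κ) := by simp only [mul_assoc]
        _ = υ t lam D x * ω κ x * E κ x * ῡ t lam D (x + unitVec κ) := by rw [ῡ_mul_υ lam D ht2 htc, mul_one]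
    simp only [gaugeF, uR, ubR, dsnd_mul, dfst_mul, fst_GfL, snd_GfL, fst_dmk, snd_dmk, zero_mul, add_zero, mul_zero, zero_add, adυ, gE, e]
    simp only [mul_assoc]

/-- [folklore] **BACKWARD CHART LEMMA**: `u(x+e_κ)·Ē(1 − ρω)·ū(x) = (υ′ Ē ῡ)·(1 − ρ Ad_υω)`. -/
theorem gaugeB_GbL (ω Eb : Form1 d (Tau 𝔸)) : gaugeB (uR t lam D) (ubR t lam D) (GbL ω Eb) = GbL (adυ t lam D ω) (gEb t lam D Eb) := by
  funext κ x
  refine TrivSqZeroExt.ext ?_ ?_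
  · simp [gaugeB, uR, ubR, gEb]
  · have e : υ t lam D (x + unitVec κ) * Eb κ x * ῡ t lam D x * (υ t lam D x * ω κ x * ῡ t lam D x)
        = υ t lam D (x + unitVec κ) * Eb κ x * ω κ x * ῡ t lam D x := by
      calc υ t lam D (x + unitVec κ) * Eb κ x * ῡ t lam D x * (υ t lam D x * ω κ x * ῡ t lam D x)
          = υ t lam D (x + unitVec κ) * Eb κ x * (ῡ t lam D x * υ t lam D x) * ω κ x * ῡ t lam D x := by simp only [mul_assoc]
        _ = υ t lam D (x + unitVec κ) * Eb κ x * ω κ x * ῡ t lam D x := by rw [ῡ_mul_υ lam D ht2 htc, mul_one]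
    simp only [gaugeB, uR, ubR, dsnd_mul, dfst_mul, fst_GbL, snd_GbL, fst_dmk, snd_dmk, zero_mul, add_zero, mul_zero, zero_add, adυ, gEb,
      e, mul_neg]
    simp only [mul_assoc, neg_mul]

omit ht2 htc in
/-- [folklore] `Ad_υ 0 = 0`. -/
theorem adυ_zero : adυ t lam D (0 : Form1 d (Tau 𝔸)) = 0 := by
  funext κ x; simp [adυ]

/-- [folklore] **THE CHART AVERAGING UNDER THE SLOT GAUGE** (G1 `PhiGAt_gauge`): `Φ^L_ρ(Ad_υω; gE, gĒ) = u(r)·Φ^L_ρ(ω; E, Ē)·ū(r + L e_μ)`. -/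
theorem PhiLAt_gauge (ρ : Fin d → ℤ) (ω E Eb : Form1 d (Tau 𝔸)) (L : ℕ) (μ : Fin d) (y : Fin d → ℤ) :
    PhiLAt 𝕜 ρ (adυ t lam D ω) (gE t lam D E) (gEb t lam D Eb) L μ y
      = uR t lam D ((L : ℤ) • y + ρ) * PhiLAt 𝕜 ρ ω E Eb L μ y * ubR t lam D ((L : ℤ) • y + ρ + (L : ℤ) • unitVec μ) := by
  rw [PhiLAt, PhiLAt, ← gaugeF_GfL lam D ht2 htc, ← gaugeB_GbL lam D ht2 htc]
  exact PhiGAt_gauge (uR_mul_ubR lam D ht2 htc) (ubR_mul_uR lam D ht2 htc) ρ L μ y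

variable (ht0 : c00 t = 0)
include ht0

omit ht2 htc in
/-- [folklore] `augR u = 1`. -/
theorem augR_uR (x : Fin d → ℤ) : augR 𝕜 (uR t lam D x) = 1 := by
  simp [uR, υ, ht0]

omit ht2 htc in
/-- [folklore] `augR ū = 1`. -/
theorem augR_ubR (x : Fin d → ℤ) : augR 𝕜 (ubR t lam D x) = 1 := by
  simp [ubR, ῡ, ht0]

set_option maxHeartbeats 800000 in
/-- [folklore] **INVERSION OF A GAUGE-CONJUGATED AVERAGING** (`augR Φ = 1`; `Rho 𝔸` is 4-step nilpotent over its augmentation, leaf-05's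
`nil4_augR`): `invT(u(r)·Φ·ū(r′)) = u(r′)·invT Φ·ū(r)`. -/
theorem invT_conj_gauge {Φ : Rho 𝔸} (hΦ : augR 𝕜 Φ = 1) (r r' : Fin d → ℤ) :
    invT (uR t lam D r * Φ * ubR t lam D r') = uR t lam D r' * invT Φ * ubR t lam D r := by
  have hg : augR 𝕜 (uR t lam D r * Φ * ubR t lam D r') = 1 := by
    rw [map_mul, map_mul, hΦ, augR_uR lam D ht0, augR_ubR lam D ht0, mul_one, mul_one]
  have h1 : Φ * invT Φ = 1 := mul_invT_eq_one (nil4_augR (𝕜 := 𝕜)) hΦ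
  have hv : uR t lam D r * Φ * ubR t lam D r' * (uR t lam D r' * invT Φ * ubR t lam D r) = 1 := by
    calc uR t lam D r * Φ * ubR t lam D r' * (uR t lam D r' * invT Φ * ubR t lam D r)
        = uR t lam D r * Φ * (ubR t lam D r' * uR t lam D r') * invT Φ * ubR t lam D r := by simp only [mul_assoc]
      _ = uR t lam D r * (Φ * invT Φ) * ubR t lam D r := by rw [ubR_mul_uR lam D ht2 htc, mul_one]; simp only [mul_assoc]
      _ = 1 := by rw [h1, mul_one, uR_mul_ubR lam D ht2 htc]
  exact (eq_invT_of_mul_eq_one (R := Rho 𝔸) (ag := augR 𝕜) nil4_augR hg hv).symm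

/-- [folklore] `logT((uΦū′)·invT(uΦ₀ū′)) = u·logT(Φ·invT Φ₀)·ū` (at the root `r`). -/
theorem logT_quot_gauge {Φ Φ₀ : Rho 𝔸} (hΦ₀ : augR 𝕜 Φ₀ = 1) (r r' : Fin d → ℤ) :
    logT 𝕜 ((uR t lam D r * Φ * ubR t lam D r') * invT (uR t lam D r * Φ₀ * ubR t lam D r'))
      = uR t lam D r * logT 𝕜 (Φ * invT Φ₀) * ubR t lam D r := by
  rw [invT_conj_gauge lam D ht2 htc ht0 hΦ₀]
  have e : uR t lam D r * Φ * ubR t lam D r' * (uR t lam D r' * invT Φ₀ * ubR t lam D r)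
      = uR t lam D r * (Φ * invT Φ₀) * ubR t lam D r := by
    calc uR t lam D r * Φ * ubR t lam D r' * (uR t lam D r' * invT Φ₀ * ubR t lam D r)
        = uR t lam D r * Φ * (ubR t lam D r' * uR t lam D r') * invT Φ₀ * ubR t lam D r := by simp only [mul_assoc]
      _ = uR t lam D r * (Φ * invT Φ₀) * ubR t lam D r := by rw [ubR_mul_uR lam D ht2 htc, mul_one]; simp only [mul_assoc]
  rw [e, logT_conj (uR_mul_ubR lam D ht2 htc r) (ubR_mul_uR lam D ht2 htc r)]

/-! ## §2 MASTER: the rooted jet of the gauge-transformed chart is the root conjugate of the rooted jet -/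

/-- [folklore] **MASTER IDENTITY** (augmentation-one backgrounds): `QjetLAt ρ (Ad_υω) (gE E) (gĒ Ē) = υ(r)·QjetLAt ρ ω E Ē·ῡ(r)`, `r = L·y + ρ`. -/
theorem QjetLAt_gauge {E Eb : Form1 d (Tau 𝔸)} (hE : ∀ κ x, c00 (E κ x) = 1) (hEb : ∀ κ x, c00 (Eb κ x) = 1) (ρ : Fin d → ℤ) (ω : Form1 d (Tau 𝔸)) (L : ℕ)
    (μ : Fin d) (y : Fin d → ℤ) :
    QjetLAt 𝕜 ρ (adυ t lam D ω) (gE t lam D E) (gEb t lam D Eb) L μ y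
      = υ t lam D ((L : ℤ) • y + ρ) * QjetLAt 𝕜 ρ ω E Eb L μ y * ῡ t lam D ((L : ℤ) • y + ρ) := by
  have h0 : augR 𝕜 (PhiLAt 𝕜 ρ 0 E Eb L μ y) = 1 :=
    aug_PhiGAt_eq_one (fun κ x => by rw [augR_GfL, hE]) (fun κ x => by rw [augR_GbL, hEb]) ρ L μ y
  unfold QjetLAt
  rw [show PhiLAt 𝕜 ρ 0 (gE t lam D E) (gEb t lam D Eb) L μ y = PhiLAt 𝕜 ρ (adυ t lam D 0) (gE t lam D E) (gEb t lam D Eb) L μ y by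
      rw [adυ_zero], PhiLAt_gauge lam D ht2 htc, PhiLAt_gauge lam D ht2 htc, logT_quot_gauge lam D ht2 htc ht0 h0]
  simp only [uR, ubR, dsnd_mul, dfst_mul, fst_dmk, snd_dmk, mul_zero, zero_add, zero_mul, add_zero]

end Slot

/-! ## §3 The expansions at node 12's letters and the component extraction -/

section Letters

/-- [folklore] Slot `τ₁`: `c11((1 + τ₁ιa)·q·(1 − τ₁ιa)) = c11 q + (a·c01 q − c01 q·a)`. -/
theorem c11_conj₁ (a : 𝔸) (q : Tau 𝔸) : c11 ((1 + τ₁ * ι a) * q * (1 - τ₁ * ι a)) = c11 q + (a * c01 q - c01 q * a) := by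
  simp [add_mul, mul_sub, mul_assoc]
  abel

/-- [folklore] Slot `τ₂`: `c11((1 + τ₂ιa)·q·(1 − τ₂ιa)) = c11 q + (a·c10 q − c10 q·a)`. -/
theorem c11_conj₂ (a : 𝔸) (q : Tau 𝔸) : c11 ((1 + τ₂ * ι a) * q * (1 - τ₂ * ι a)) = c11 q + (a * c10 q - c10 q * a) := by
  simp [add_mul, mul_sub, mul_assoc]
  abel

/-- [folklore] The conjugated SCALAR fluctuation: `Ad_υ(upF W) = upF W + t·upF(β₁ W)`. -/
theorem adυ_upF (ht2 : t * t = 0) (htc : ∀ q : Tau 𝔸, t * q = q * t) (W : Form1 d 𝔸) :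
    adυ t lam D (upF W) = upF W + fun κ x => t * upF (βg1 lam D W) κ x := by
  funext κ x
  have h0 : t * ι (lam x • D) * ι (W κ x) * (t * ι (lam x • D)) = 0 := by
    calc t * ι (lam x • D) * ι (W κ x) * (t * ι (lam x • D))
        = t * (ι (lam x • D) * ι (W κ x) * t) * ι (lam x • D) := by simp only [mul_assoc]
      _ = t * (t * (ι (lam x • D) * ι (W κ x))) * ι (lam x • D) := by rw [← htc (ι (lam x • D) * ι (W κ x))]
      _ = 0 := by rw [← mul_assoc t t, ht2, zero_mul, zero_mul]
  simp only [adυ, υ, ῡ, Pi.add_apply, upF_apply, βg1, add_mul, mul_sub, one_mul, mul_one, h0]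
  have e1 : ι (W κ x) * (t * ι (lam x • D)) = t * (ι (W κ x) * ι (lam x • D)) := by rw [← mul_assoc, ← htc (ι (W κ x)), mul_assoc]
  rw [e1]
  have e2 : ι ((lam x • D) * W κ x - W κ x * (lam x • D)) = ι (lam x • D) * ι (W κ x) - ι (W κ x) * ι (lam x • D) :=
    ext4 (by simp) (by simp) (by simp) (by simp)
  rw [e2, mul_sub, mul_assoc]
  abel

/-- [folklore] The `Tau` identity behind slot `τ₁`'s forward expansion. -/
theorem conj₁_Ebg (A A' b b' : 𝔸) :
    (1 + τ₁ * ι A) * ((1 + τ₁ * ι b) * (1 + τ₂ * ι b')) * (1 - τ₁ * ι A')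
      = ((1 + τ₁ * ι (b - (A' - A))) * (1 + τ₂ * ι b')) * (1 + τ12 * ι (A' * b' - b' * A')) :=
  ext4 (by simp) (by simp; abel) (by simp) (by simp [add_mul, mul_sub, sub_mul]; noncomm_ring)

/-- [folklore] The `Tau` identity behind slot `τ₁`'s backward expansion. -/
theorem conj₁_Ebi (A A' b b' : 𝔸) :
    (1 + τ₁ * ι A') * ((1 - τ₂ * ι b') * (1 - τ₁ * ι b)) * (1 - τ₁ * ι A)
      = (1 - τ12 * ι (A' * b' - b' * A')) * ((1 - τ₂ * ι b') * (1 - τ₁ * ι (b - (A' - A)))) :=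
  ext4 (by simp) (by simp; abel) (by simp) (by simp [mul_add, add_mul, mul_sub]; noncomm_ring)

/-- [folklore] The `Tau` identity behind slot `τ₂`'s forward expansion. -/
theorem conj₂_Ebg (A A' b b' : 𝔸) :
    (1 + τ₂ * ι A) * ((1 + τ₁ * ι b) * (1 + τ₂ * ι b')) * (1 - τ₂ * ι A')
      = ((1 + τ₁ * ι b) * (1 + τ₂ * ι (b' - (A' - A)))) * (1 + τ12 * ι (A * b - b * A)) :=
  ext4 (by simp) (by simp) (by simp; abel) (by simp [add_mul, mul_sub]; noncomm_ring)

/-- [folklore] The `Tau` identity behind slot `τ₂`'s backward expansion. -/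
theorem conj₂_Ebi (A A' b b' : 𝔸) :
    (1 + τ₂ * ι A') * ((1 - τ₂ * ι b') * (1 - τ₁ * ι b)) * (1 - τ₂ * ι A)
      = (1 - τ12 * ι (A * b - b * A)) * ((1 - τ₂ * ι (b' - (A' - A))) * (1 - τ₁ * ι b)) :=
  ext4 (by simp) (by simp) (by simp; abel) (by simp [add_mul, mul_sub, sub_mul]; noncomm_ring)

/-- [folklore] **SLOT `τ₁`, FORWARD**: `gE (Ebg B B′) = Ebg (B − dA) B′ · (1 + τ₁τ₂ ι βfar(B′))`. -/
theorem gE₁_Ebg (B B' : Form1 d 𝔸) :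
    gE τ₁ lam D (Ebg B B') = fun κ x => Ebg (B - fun κ x => (lam (x + unitVec κ) - lam x) • D) B' κ x * (1 + τ12 * ι (βfar lam D B' κ x)) := by
  funext κ x
  simp only [gE, υ, ῡ, Ebg, Pi.sub_apply, sub_smul, βfar]
  exact conj₁_Ebg _ _ _ _

/-- [folklore] **SLOT `τ₁`, BACKWARD**: `gEb (Ebi B B′) = (1 − τ₁τ₂ ι βfar(B′)) · Ebi (B − dA) B′`. -/
theorem gEb₁_Ebi (B B' : Form1 d 𝔸) :
    gEb τ₁ lam D (Ebi B B') = fun κ x => (1 - τ12 * ι (βfar lam D B' κ x)) * Ebi (B - fun κ x => (lam (x + unitVec κ) - lam x) • D) B' κ x := by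
  funext κ x
  simp only [gEb, υ, ῡ, Ebi, Pi.sub_apply, sub_smul, βfar]
  exact conj₁_Ebi _ _ _ _

/-- [folklore] **SLOT `τ₂`, FORWARD**: `gE (Ebg B B′) = Ebg B (B′ − dA) · (1 + τ₁τ₂ ι β₁(B))`. -/
theorem gE₂_Ebg (B B' : Form1 d 𝔸) :
    gE τ₂ lam D (Ebg B B') = fun κ x => Ebg B (B' - fun κ x => (lam (x + unitVec κ) - lam x) • D) κ x * (1 + τ12 * ι (βg1 lam D B κ x)) := by
  funext κ x
  simp only [gE, υ, ῡ, Ebg, Pi.sub_apply, sub_smul, βg1]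
  exact conj₂_Ebg _ _ _ _

/-- [folklore] **SLOT `τ₂`, BACKWARD**: `gEb (Ebi B B′) = (1 − τ₁τ₂ ι β₁(B)) · Ebi B (B′ − dA)`. -/
theorem gEb₂_Ebi (B B' : Form1 d 𝔸) :
    gEb τ₂ lam D (Ebi B B') = fun κ x => (1 - τ12 * ι (βg1 lam D B κ x)) * Ebi B (B' - fun κ x => (lam (x + unitVec κ) - lam x) • D) κ x := by
  funext κ x
  simp only [gEb, υ, ῡ, Ebi, Pi.sub_apply, sub_smul, βg1]
  exact conj₂_Ebi _ _ _ _

/-- [folklore] `c11 Q^ρ(upF W; 0, X) = 0` (no `τ₁`-letter anywhere; via 33J's sign flip, char ≠ 2). -/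
theorem c11_QjetAt_upF_zero_B (h2 : (2 : 𝕜) ≠ 0) (ρ : Fin d → ℤ) (W X : Form1 d 𝔸) (L : ℕ) (μ : Fin d) (y : Fin d → ℤ) :
    c11 (QjetAt 𝕜 ρ (upF W) 0 X L μ y) = 0 := by
  have h := congrArg c11 (QjetAt_upF_neg_B (𝕜 := 𝕜) ρ W 0 X L μ y)
  rw [neg_zero, c11_flip1] at h
  have h' : (2 : 𝕜) • c11 (QjetAt 𝕜 ρ (upF W) 0 X L μ y) = 0 := by rw [two_smul]; nth_rewrite 1 [h]; exact neg_add_cancel _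
  exact (smul_eq_zero.1 h').resolve_left h2

/-- [folklore] `c11 Q^ρ(upF W; X, 0) = 0`. -/
theorem c11_QjetAt_upF_zero_B' (h2 : (2 : 𝕜) ≠ 0) (ρ : Fin d → ℤ) (W X : Form1 d 𝔸) (L : ℕ) (μ : Fin d) (y : Fin d → ℤ) :
    c11 (QjetAt 𝕜 ρ (upF W) X 0 L μ y) = 0 := by
  have h := congrArg c11 (QjetAt_upF_neg_B' (𝕜 := 𝕜) ρ W X 0 L μ y)
  rw [neg_zero, c11_flip2] at h
  have h' : (2 : 𝕜) • c11 (QjetAt 𝕜 ρ (upF W) X 0 L μ y) = 0 := by rw [two_smul]; nth_rewrite 1 [h]; exact neg_add_cancel _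
  exact (smul_eq_zero.1 h').resolve_left h2

end Letters

/-! ## §4 The border jet Ward identities -/

section Ward

variable {L : ℕ} (hL : (L : 𝕜) ≠ 0) (h2 : (2 : 𝕜) ≠ 0)
include hL h2

/-- [folklore] **THE BORDER JET WARD IDENTITY, SLOT `τ₁`**: for a scalar fluctuation `upF W`, the pure-gauge background `dA` in the `τ₁`-slot and
any spectator `X` in the `τ₂`-slot,
`c11 Q^ρ(upF W; dA, X) = (2ℓ²)⁻¹•vhUAt ρ W (βfar X) + (2ℓ²)⁻¹•vhUAt ρ (β₁ W) X − [λ(r)•D, (2ℓ²)⁻¹•vhUAt ρ W X]`. -/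
theorem c11_QjetAt_gauge₁ (ρ : Fin d → ℤ) (W X : Form1 d 𝔸) (μ : Fin d) (y : Fin d → ℤ) :
    c11 (QjetAt 𝕜 ρ (upF W) (fun κ x => (lam (x + unitVec κ) - lam x) • D) X L μ y)
      = ((2 : 𝕜) * (L : 𝕜) ^ (2 * d))⁻¹ • vhUAt ρ W (βfar lam D X) L μ y
        + ((2 : 𝕜) * (L : 𝕜) ^ (2 * d))⁻¹ • vhUAt ρ (βg1 lam D W) X L μ y
        - ((lam ((L : ℤ) • y + ρ) • D) * (((2 : 𝕜) * (L : 𝕜) ^ (2 * d))⁻¹ • vhUAt ρ W X L μ y)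
            - (((2 : 𝕜) * (L : 𝕜) ^ (2 * d))⁻¹ • vhUAt ρ W X L μ y) * (lam ((L : ℤ) • y + ρ) • D)) := by
  -- MASTER at t = τ₁, E = Ebg dA X, Ē = Ebi dA X, ω = upF W
  have key := congrArg c11 (QjetLAt_gauge (t := τ₁) lam D AveragingThirdJet.Tau.τ₁_mul_τ₁ τ₁_comm AveragingThirdJet.Tau.c00_τ₁
    (E := Ebg (fun κ x => (lam (x + unitVec κ) - lam x) • D) X) (Eb := Ebi (fun κ x => (lam (x + unitVec κ) - lam x) • D) X) (fun κ x => AveragingThirdJet.c00_Ebg _ _ κ x) (fun κ x => AveragingThirdJet.c00_Ebi _ _ κ x) ρ (upF W) L μ y)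
  rw [gE₁_Ebg, gEb₁_Ebi, adυ_upF τ₁ lam D AveragingThirdJet.Tau.τ₁_mul_τ₁ τ₁_comm, QjetLAt_add, QjetLAt_τ₁_mul,
    AveragingThirdJet.Tau.c11_add, AveragingThirdJet.Tau.c11_τ₁_mul,
    c11_QjetLAt_twist_of_aug _ _ _ _ (fun κ x => AveragingThirdJet.c00_Ebg _ _ κ x) (fun κ x => AveragingThirdJet.c00_Ebi _ _ κ x),
    c01_QjetLAt_twist, ← QjetAt_eq_QjetLAt, ← QjetAt_eq_QjetLAt, ← QjetAt_eq_QjetLAt] at key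
  simp only [sub_self] at key
  rw [c11_QjetAt_upF_zero_B h2, zero_add, υ, ῡ, c11_conj₁] at key
  have eW : (fun κ x => ι (c00 (upF W κ x))) = upF W := by funext κ x; simp
  rw [eW, c10_QjetAt_upF (hL := hL) (h2 := h2), c01_QjetAt_upF (hL := hL) (h2 := h2), c01_QjetAt_upF (hL := hL) (h2 := h2)] at key
  -- key : (2ℓ²)⁻¹•vh(W, βfar X) + (2ℓ²)⁻¹•vh(β₁ W, X) = c11 Q(upF W; dA, X) + (a·c01 − c01·a)
  rw [eq_sub_iff_add_eq]
  exact key.symm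

/-- [folklore] **THE BORDER JET WARD IDENTITY, SLOT `τ₂`**: `c11 Q^ρ(upF W; X, dA) = (2ℓ²)⁻¹•vhUAt ρ W (β₁ X) + (2ℓ²)⁻¹•vhUAt ρ (β₁ W) X
− [λ(r)•D, (2ℓ²)⁻¹•vhUAt ρ W X]`. -/
theorem c11_QjetAt_gauge₂ (ρ : Fin d → ℤ) (W X : Form1 d 𝔸) (μ : Fin d) (y : Fin d → ℤ) :
    c11 (QjetAt 𝕜 ρ (upF W) X (fun κ x => (lam (x + unitVec κ) - lam x) • D) L μ y)
      = ((2 : 𝕜) * (L : 𝕜) ^ (2 * d))⁻¹ • vhUAt ρ W (βg1 lam D X) L μ y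
        + ((2 : 𝕜) * (L : 𝕜) ^ (2 * d))⁻¹ • vhUAt ρ (βg1 lam D W) X L μ y
        - ((lam ((L : ℤ) • y + ρ) • D) * (((2 : 𝕜) * (L : 𝕜) ^ (2 * d))⁻¹ • vhUAt ρ W X L μ y)
            - (((2 : 𝕜) * (L : 𝕜) ^ (2 * d))⁻¹ • vhUAt ρ W X L μ y) * (lam ((L : ℤ) • y + ρ) • D)) := by
  have key := congrArg c11 (QjetLAt_gauge (t := τ₂) lam D AveragingThirdJet.Tau.τ₂_mul_τ₂ τ₂_comm AveragingThirdJet.Tau.c00_τ₂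
    (E := Ebg X (fun κ x => (lam (x + unitVec κ) - lam x) • D)) (Eb := Ebi X (fun κ x => (lam (x + unitVec κ) - lam x) • D)) (fun κ x => AveragingThirdJet.c00_Ebg _ _ κ x) (fun κ x => AveragingThirdJet.c00_Ebi _ _ κ x) ρ (upF W) L μ y)
  rw [gE₂_Ebg, gEb₂_Ebi, adυ_upF τ₂ lam D AveragingThirdJet.Tau.τ₂_mul_τ₂ τ₂_comm, QjetLAt_add, QjetLAt_τ₂_mul,
    AveragingThirdJet.Tau.c11_add, AveragingThirdJet.Tau.c11_τ₂_mul,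
    c11_QjetLAt_twist_of_aug _ _ _ _ (fun κ x => AveragingThirdJet.c00_Ebg _ _ κ x) (fun κ x => AveragingThirdJet.c00_Ebi _ _ κ x),
    c10_QjetLAt_twist, ← QjetAt_eq_QjetLAt, ← QjetAt_eq_QjetLAt, ← QjetAt_eq_QjetLAt] at key
  simp only [sub_self] at key
  rw [c11_QjetAt_upF_zero_B' h2, zero_add, υ, ῡ, c11_conj₂] at key
  have eW : (fun κ x => ι (c00 (upF W κ x))) = upF W := by funext κ x; simp
  rw [eW, c10_QjetAt_upF (hL := hL) (h2 := h2), c10_QjetAt_upF (hL := hL) (h2 := h2), c10_QjetAt_upF (hL := hL) (h2 := h2)] at key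
  rw [eq_sub_iff_add_eq]
  exact key.symm

/-- [folklore] **THE GAUGE WARD IDENTITY OF THE ROOTED BORDER JET `T2At`** (the sum of the two slots):
`T2At ρ (upF W) dA X = [slot τ₁] + [slot τ₂]` — every term a first-order (`vhUAt`) functional. -/
theorem T2At_gauge (ρ : Fin d → ℤ) (W X : Form1 d 𝔸) (μ : Fin d) (y : Fin d → ℤ) :
    T2At 𝕜 ρ (upF W) (fun κ x => (lam (x + unitVec κ) - lam x) • D) X L μ y
      = (((2 : 𝕜) * (L : 𝕜) ^ (2 * d))⁻¹ • vhUAt ρ W (βfar lam D X) L μ y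
          + ((2 : 𝕜) * (L : 𝕜) ^ (2 * d))⁻¹ • vhUAt ρ (βg1 lam D W) X L μ y
          - ((lam ((L : ℤ) • y + ρ) • D) * (((2 : 𝕜) * (L : 𝕜) ^ (2 * d))⁻¹ • vhUAt ρ W X L μ y)
              - (((2 : 𝕜) * (L : 𝕜) ^ (2 * d))⁻¹ • vhUAt ρ W X L μ y) * (lam ((L : ℤ) • y + ρ) • D)))
        + (((2 : 𝕜) * (L : 𝕜) ^ (2 * d))⁻¹ • vhUAt ρ W (βg1 lam D X) L μ y
          + ((2 : 𝕜) * (L : 𝕜) ^ (2 * d))⁻¹ • vhUAt ρ (βg1 lam D W) X L μ y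
          - ((lam ((L : ℤ) • y + ρ) • D) * (((2 : 𝕜) * (L : 𝕜) ^ (2 * d))⁻¹ • vhUAt ρ W X L μ y)
              - (((2 : 𝕜) * (L : 𝕜) ^ (2 * d))⁻¹ • vhUAt ρ W X L μ y) * (lam ((L : ℤ) • y + ρ) • D))) := by
  rw [T2At, c11_QjetAt_gauge₁ lam D hL h2, c11_QjetAt_gauge₂ lam D hL h2]

end Ward

end Summit.QuantumFields.BalabanUV.Beta.BorderJetWard
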